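import Mathlib.Algebra.MvPolynomial.CommRing
import Mathlib.RingTheory.Ideal.Span
import Mathlib.Tactic.Ring
import Mathlib.Tactic.FinCases
import HarnessLib

/-!
# The threefold forms: chart identities of `X₀²X₁ + X₁²X₂ + X₂²X₀ + X₀X₃³ + X₁X₂X₃²`

Support file for crux stmt-ResolutionOfSingularities-15315
(`FrobeniusLadder.FInjectiveMacaulayfication`, line `Sketch`, lead seat c7, cycle 8): stub
`stub_threefoldIdentities` of the §13 THREEFOLD CALIBRATION (dimension three; the calibration lives in
characteristic `2`, but everything in this file holds over EVERY field `k`).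

The germ is `f = X₀²X₁ + X₁²X₂ + X₂²X₀ + X₀X₃³ + X₁X₂X₃² ∈ k[X₀, X₁, X₂, X₃]` (an isolated triple
point). On the chart of the generator `Xᵢ` of the blow-up of the origin, the substitution
`θᵢ : Xᵢ ↦ Xᵢ, Xⱼ ↦ Xⱼ Xᵢ (j ≠ i)` turns `f` into `Xᵢ³ · gᵢ` with the strict transforms

* `g₀ = X₁ + X₁²X₂ + X₂² + X₀X₃³ + X₀X₁X₂X₃²`,
* `g₁ = X₀² + X₂ + X₀X₂² + X₀X₁X₃³ + X₁X₂X₃²`,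
* `g₂ = X₀²X₁ + X₁² + X₀ + X₀X₂X₃³ + X₁X₂X₃²`,
* `g₃ = X₀²X₁ + X₁²X₂ + X₂²X₀ + X₀X₃ + X₁X₂X₃`.

What is proved:

* `not_mem_span_singleton_of_map` — the evaluation test: if a ring hom kills `g` but not `x`, then
  `x ∉ (g)`.
* `stub_threefoldIdentities` — the registered statement: `f ≠ 0` (evaluate at `(1,1,0,0)`), no
  variable lies in `(f)` (`f` vanishes at the four coordinate points, `Xᵢ` does not), the four
  identities `θᵢ f = Xᵢ³ gᵢ` (`ring`), and `Xᵢ ∉ (gᵢ)` (`gᵢ` vanishes at the `i`-th coordinate point).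

The algebra is folklore.
-/

-- single-problem summit: the doubled namespace component is forced
set_option linter.dupNamespace false

namespace Summit.ResolutionOfSingularities.ResolutionOfSingularities.Theorems.FInjectiveMacaulayfication.ThreefoldIdentities

open MvPolynomial

/-- **Evaluation test for non-membership in a principal ideal.** If a ring homomorphism `φ` kills
`g` but not `x`, then `x ∉ (g)`: from `x = g · q` we would get `φ x = φ g · φ q = 0`. [folklore] -/
theorem not_mem_span_singleton_of_map {R S : Type*} [CommRing R] [CommRing S] (φ : R →+* S)
    {g x : R} (hg : φ g = 0) (hx : φ x ≠ 0) : x ∉ Ideal.span {g} := by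
  intro h
  obtain ⟨q, rfl⟩ := Ideal.mem_span_singleton.mp h
  exact hx (by rw [map_mul, hg, zero_mul])

/-- **The threefold forms — identities** (registered stub `stub_threefoldIdentities` of the §13
calibration; pure polynomial algebra over ANY field): for
`f = X₀²X₁ + X₁²X₂ + X₂²X₀ + X₀X₃³ + X₁X₂X₃²` and its four strict transforms `g₀, …, g₃` under the
point blow-up (multiplicity `3`): `f ≠ 0`, no variable lies in `(f)`, and for each chart
`θᵢ f = Xᵢ³ gᵢ` with `Xᵢ ∉ (gᵢ)`. Proof: the identities are `ring` after expanding `aeval`; `f ≠ 0`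
by evaluating at `(1,1,0,0) ↦ 1`; the non-memberships by `not_mem_span_singleton_of_map` with the
evaluation at the `i`-th coordinate point, where `f` and `gᵢ` vanish but `Xᵢ ↦ 1`. [folklore] -/
theorem stub_threefoldIdentities : ∀ (k : Type) [Field k] (f g₀ g₁ g₂ g₃ : MvPolynomial (Fin 4) k),
    f = MvPolynomial.X 0 ^ 2 * MvPolynomial.X 1 + MvPolynomial.X 1 ^ 2 * MvPolynomial.X 2 + MvPolynomial.X 2 ^ 2 * MvPolynomial.X 0 + MvPolynomial.X 0 * MvPolynomial.X 3 ^ 3 + MvPolynomial.X 1 * MvPolynomial.X 2 * MvPolynomial.X 3 ^ 2 →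
    g₀ = MvPolynomial.X 1 + MvPolynomial.X 1 ^ 2 * MvPolynomial.X 2 + MvPolynomial.X 2 ^ 2 + MvPolynomial.X 0 * MvPolynomial.X 3 ^ 3 + MvPolynomial.X 0 * MvPolynomial.X 1 * MvPolynomial.X 2 * MvPolynomial.X 3 ^ 2 →
    g₁ = MvPolynomial.X 0 ^ 2 + MvPolynomial.X 2 + MvPolynomial.X 0 * MvPolynomial.X 2 ^ 2 + MvPolynomial.X 0 * MvPolynomial.X 1 * MvPolynomial.X 3 ^ 3 + MvPolynomial.X 1 * MvPolynomial.X 2 * MvPolynomial.X 3 ^ 2 →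
    g₂ = MvPolynomial.X 0 ^ 2 * MvPolynomial.X 1 + MvPolynomial.X 1 ^ 2 + MvPolynomial.X 0 + MvPolynomial.X 0 * MvPolynomial.X 2 * MvPolynomial.X 3 ^ 3 + MvPolynomial.X 1 * MvPolynomial.X 2 * MvPolynomial.X 3 ^ 2 →
    g₃ = MvPolynomial.X 0 ^ 2 * MvPolynomial.X 1 + MvPolynomial.X 1 ^ 2 * MvPolynomial.X 2 + MvPolynomial.X 2 ^ 2 * MvPolynomial.X 0 + MvPolynomial.X 0 * MvPolynomial.X 3 + MvPolynomial.X 1 * MvPolynomial.X 2 * MvPolynomial.X 3 →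
    f ≠ 0 ∧ (∀ i : Fin 4, MvPolynomial.X i ∉ Ideal.span {f}) ∧
    (MvPolynomial.aeval (fun j : Fin 4 => if j = 0 then (MvPolynomial.X 0 : MvPolynomial (Fin 4) k)
        else MvPolynomial.X j * MvPolynomial.X 0) f = MvPolynomial.X 0 ^ 3 * g₀ ∧ MvPolynomial.X 0 ∉ Ideal.span {g₀}) ∧
    (MvPolynomial.aeval (fun j : Fin 4 => if j = 1 then (MvPolynomial.X 1 : MvPolynomial (Fin 4) k)
        else MvPolynomial.X j * MvPolynomial.X 1) f = MvPolynomial.X 1 ^ 3 * g₁ ∧ MvPolynomial.X 1 ∉ Ideal.span {g₁}) ∧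
    (MvPolynomial.aeval (fun j : Fin 4 => if j = 2 then (MvPolynomial.X 2 : MvPolynomial (Fin 4) k)
        else MvPolynomial.X j * MvPolynomial.X 2) f = MvPolynomial.X 2 ^ 3 * g₂ ∧ MvPolynomial.X 2 ∉ Ideal.span {g₂}) ∧
    (MvPolynomial.aeval (fun j : Fin 4 => if j = 3 then (MvPolynomial.X 3 : MvPolynomial (Fin 4) k)
        else MvPolynomial.X j * MvPolynomial.X 3) f = MvPolynomial.X 3 ^ 3 * g₃ ∧ MvPolynomial.X 3 ∉ Ideal.span {g₃}) := by
  intro k _ f g₀ g₁ g₂ g₃ hf hg₀ hg₁ hg₂ hg₃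
  -- the evaluation at the `i`-th coordinate point: `Xᵢ ↦ 1`, `Xⱼ ↦ 0`
  have hpt : ∀ i : Fin 4,
      MvPolynomial.eval (fun j : Fin 4 => if j = i then (1 : k) else 0) (MvPolynomial.X i) ≠ 0 := by
    intro i
    rw [MvPolynomial.eval_X, if_pos rfl]
    exact one_ne_zero
  have hf0 : ∀ i : Fin 4,
      MvPolynomial.eval (fun j : Fin 4 => if j = i then (1 : k) else 0) f = 0 := by
    intro i
    subst hf
    fin_cases i <;>
      simp only [Fin.reduceFinMk, map_add, map_mul, map_pow, MvPolynomial.eval_X, Fin.isValue,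
        Fin.reduceEq, ↓reduceIte] <;> ring
  subst hf hg₀ hg₁ hg₂ hg₃
  refine ⟨?_, fun i => not_mem_span_singleton_of_map _ (hf0 i) (hpt i), ⟨?_, ?_⟩, ⟨?_, ?_⟩,
    ⟨?_, ?_⟩, ⟨?_, ?_⟩⟩
  · -- `f ≠ 0`: `f(1,1,0,0) = 1`
    intro h0
    have h1 := congrArg
      (MvPolynomial.eval (fun j : Fin 4 => if j = 0 ∨ j = 1 then (1 : k) else 0)) h0
    simp only [map_add, map_mul, map_pow, MvPolynomial.eval_X, Fin.isValue, Fin.reduceEq,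
      or_true, or_false, ↓reduceIte, map_zero] at h1
    norm_num at h1
  · simp only [map_add, map_mul, map_pow, MvPolynomial.aeval_X, Fin.isValue, Fin.reduceEq,
      ↓reduceIte]
    ring
  · refine not_mem_span_singleton_of_map _ ?_ (hpt 0)
    simp only [map_add, map_mul, map_pow, MvPolynomial.eval_X, Fin.isValue, Fin.reduceEq,
      ↓reduceIte]
    ring
  · simp only [map_add, map_mul, map_pow, MvPolynomial.aeval_X, Fin.isValue, Fin.reduceEq,
      ↓reduceIte]
    ring
  · refine not_mem_span_singleton_of_map _ ?_ (hpt 1)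
    simp only [map_add, map_mul, map_pow, MvPolynomial.eval_X, Fin.isValue, Fin.reduceEq,
      ↓reduceIte]
    ring
  · simp only [map_add, map_mul, map_pow, MvPolynomial.aeval_X, Fin.isValue, Fin.reduceEq,
      ↓reduceIte]
    ring
  · refine not_mem_span_singleton_of_map _ ?_ (hpt 2)
    simp only [map_add, map_mul, map_pow, MvPolynomial.eval_X, Fin.isValue, Fin.reduceEq,
      ↓reduceIte]
    ring
  · simp only [map_add, map_mul, map_pow, MvPolynomial.aeval_X, Fin.isValue, Fin.reduceEq,
      ↓reduceIte]
    ring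
  · refine not_mem_span_singleton_of_map _ ?_ (hpt 3)
    simp only [map_add, map_mul, map_pow, MvPolynomial.eval_X, Fin.isValue, Fin.reduceEq,
      ↓reduceIte]
    ring

end Summit.ResolutionOfSingularities.ResolutionOfSingularities.Theorems.FInjectiveMacaulayfication.ThreefoldIdentities
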